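import Summits.SmoothPoincare4.SmoothPoincare4.Theorems.ConvexBisectionContractibleTwistedDoubleStandardStubSeam
import Summits.SmoothPoincare4.SmoothPoincare4.Theorems.ConvexBisectionContractibleTwistedDoubleStandardStubDoubleIsHomotopySphere
import Literature.AlgebraicTopology.Homotopy.CollarGluing
import HarnessLib

/-!
# A contact Stein bisection by two compact contractible domains is a homotopy 4-sphere
(helper of line `property-r-mazur-halves`, crux `ConvexBisection.ContractibleTwistedDoubleStandard`,
item stmt-SmoothPoincare4-3546; lead prover-line-stmt-SmoothPoincare4-3546-c5-0)

The informal statement of the crux says "such `X` is automatically a homotopy sphere (van Kampen +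
Mayer–Vietoris)"; the standing disprover's work file (`Cruxes/…/Disproof.lean` v9, "Not formalisable
here") records that `crux ← SPC4` and `¬crux → ¬SPC4` were proved only RELATIVE to this lemma, and the
landed `LegendrianRKnotRigidity.nonempty_homotopyEquiv_sphere_of_isDouble`
(`…StubDoubleIsHomotopySphere.lean`) covers only the untwisted double `W ∪_{id} W`.  This file proves
the general TWISTED case, for the crux's own data:

* `gluingData_nonempty_singularHomology_iso` — Mayer–Vietoris for a gluing `P = W₁ ∪_A W₂` of two
  CONTRACTIBLE collared pieces (`BoundaryCollar.GluingData`, the two-piece version of the tree's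
  `DoubleData.nonempty_singularHomology_iso`): `Hₖ₊₁(P; M) ≅ Hₖ(A; M)` for `k ≥ 1`.
* `nonempty_homotopyEquiv_sphere_of_steinBisection` — if a Hausdorff second-countable smooth
  `4`-manifold `X` is covered by two smoothly embedded compact contractible Stein domains meeting
  exactly along the images of both boundaries, with matched complex tangencies (the six hypotheses of
  the crux, `[CompactSpace X]` not needed), then `X ≃ₕ S⁴`.  Proof: the seam contactomorphism
  `ψ : ∂W₁ ≅ ∂W₂` of the landed `stub_seam`; a collar of `∂W₂` (`NullCobordism.exists_boundaryCollar`);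
  the resulting `GluingData`; van Kampen (`GluingData.simplyConnectedSpace`) and the Mayer–Vietoris
  isomorphism `H₂(X; ℤ) ≅ H₁(∂W₂; ℤ) = 0` (Alexander duality, Kervaire–Milnor Lemma 2.3,
  `NullCobordism.isZero_singularHomology_of_alexander`); recognition of homotopy `4`-spheres
  (`nonempty_homotopyEquiv_sphere_four_iff_holds`, Freedman–Quinn 1990 §10.1, proved in the tree).
* `stub_homotopySphere` — the same in the binder order of the crux (registered stub of skeleton m10
  of the line; it feeds the bet, now stated over homotopy `4`-spheres).

No named fact, no `sorry`.

## References

* M. Kervaire, J. Milnor, *Groups of homotopy spheres I*, Ann. of Math. 77 (1963), Lemma 2.3.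
  [KervaireMilnorAnnals1963]
* M. H. Freedman, F. Quinn, *Topology of 4-manifolds* (1990), §10.1. [FreedmanQuinnPMS1990]
* A. Hatcher, *Algebraic Topology* (2002), Lemma 1.15, §2.2 p. 149. [HatcherAT2002]
-/

noncomputable section

-- the prescribed namespace `Summit.<P>.<Sub>.…` duplicates `SmoothPoincare4` (P = Sub)
set_option linter.dupNamespace false

open scoped Manifold ContDiff Topology ContinuousMap unitInterval
open Set Function Literature.Topology.FourManifolds Literature.Geometry.Symplectic
open CategoryTheory CategoryTheory.Limits
open Literature.AlgebraicTopology.SingularHomology Literature.AlgebraicTopology.Homotopy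

namespace Summit.SmoothPoincare4.SmoothPoincare4.Theorems.ContractibleTwistedDoubleStandard.PropertyRMazurHalves

universe u v

/-! ### Mayer–Vietoris for a gluing of two contractible collared pieces -/

section Gluing

variable {A : Type u} [TopologicalSpace A] [Nonempty A]
  {W₁ : Type u} [TopologicalSpace W₁] {W₂ : Type u} [TopologicalSpace W₂]
  {κ : BoundaryCollar W₂ A} {i₁ : A → W₁} {P : Type u} [TopologicalSpace P]
  (d : κ.GluingData i₁ P)
  (R : Type v) [CommRing R] (M : Type v) [AddCommGroup M] [Module R M]

/-- `Hₖ(V; M) = 0` for `k ≥ 1` when the collared piece `W₂` is contractible (`V ≃ W₂`). [folklore] -/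
theorem gluingData_isZero_singularHomology_V [ContractibleSpace W₂] {t : I} (ht : 0 < t) {k : ℕ}
    (hk : k ≠ 0) : IsZero (singularHomology R M ↥d.V k) := by
  haveI : ContractibleSpace ↥d.V := (d.homotopyEquivV ht).contractibleSpace
  exact isZero_singularHomology_of_contractibleSpace R M hk

/-- **The Mayer–Vietoris connecting map `δ : Hₖ₊₁(P) → Hₖ(U t ∩ V)` of a gluing of two
contractible collared pieces is an isomorphism for `k ≥ 1`** (Hatcher 2002, §2.2, p. 149: the outer
terms `Hⱼ(U) ⊕ Hⱼ(V)` of the Mayer–Vietoris sequence vanish; two-piece version of the tree's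
`DoubleData.isIso_mayerVietoris_δ`). [cite: HatcherAT2002, §2.2 p. 149] -/
theorem gluingData_isIso_mayerVietoris_δ [ContractibleSpace W₁] [ContractibleSpace W₂] {t : I}
    (ht : 0 < t) {k : ℕ} (hk : k ≠ 0) :
    IsIso (mayerVietoris.δ R M (d.U t) d.V
      (relativeSingularHomology.isIso_map_of_interior_union_interior_holds R M P)
      (d.interior_U_union_interior_V ht) k) := by
  have hexc := relativeSingularHomology.isIso_map_of_interior_union_interior_holds R M P
  have hUV := d.interior_U_union_interior_V ht
  have hψ : mayerVietoris.ψ R M (d.U t) d.V (k + 1) = 0 := by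
    refine biprod.hom_ext' _ _ ?_ ?_
    · exact (d.isZero_singularHomology_U R M ht k.succ_ne_zero).eq_of_src _ _
    · exact (gluingData_isZero_singularHomology_V d R M ht k.succ_ne_zero).eq_of_src _ _
  haveI : Mono (mayerVietoris.δ R M (d.U t) d.V hexc hUV k) :=
    (mayerVietoris.exact₂_holds R M (d.U t) d.V hexc hUV k).mono_g hψ
  have hφ : mayerVietoris.φ R M (d.U t) d.V k = 0 := by
    refine biprod.hom_ext _ _ ?_ ?_
    · exact (d.isZero_singularHomology_U R M ht hk).eq_of_tgt _ _
    · exact (gluingData_isZero_singularHomology_V d R M ht hk).eq_of_tgt _ _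
  haveI : Epi (mayerVietoris.δ R M (d.U t) d.V hexc hUV k) :=
    (mayerVietoris.exact₃_holds R M (d.U t) d.V hexc hUV k).epi_f hφ
  exact isIso_of_mono_of_epi _

include d in
/-- **Homology of a gluing of two contractible collared pieces**: `Hₖ₊₁(W₁ ∪_A W₂; M) ≅ Hₖ(A; M)`
for every `k ≥ 1` (Mayer–Vietoris for the open cover `U t ≃ W₁`, `V ≃ W₂`, `U t ∩ V ≃ A`; Hatcher
2002, §2.2, p. 149).  For a twisted double `W₁ ∪_ψ W₂` of compact contractible manifolds:
`Hₖ₊₁ ≅ Hₖ(∂W₂)`. [cite: HatcherAT2002, §2.2 p. 149] -/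
theorem gluingData_nonempty_singularHomology_iso [ContractibleSpace W₁] [ContractibleSpace W₂]
    {k : ℕ} (hk : k ≠ 0) : Nonempty (singularHomology R M P (k + 1) ≅ singularHomology R M A k) := by
  have ht : (0 : I) < 1 := zero_lt_one
  obtain ⟨u, hu, hut⟩ := BoundaryCollar.DoubleData.exists_level_between ht
  haveI := gluingData_isIso_mayerVietoris_δ d R M ht hk
  have e : singularHomology R M A k ≅ singularHomology R M ↥(d.U 1 ∩ d.V) k :=
    singularHomology.isoOfHomotopyEquiv R M
      ((κ.stripHomotopyEquiv hu hut).trans (d.UInterVHomeomorph 1).toHomotopyEquiv) k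
  exact ⟨asIso (mayerVietoris.δ R M (d.U 1) d.V
      (relativeSingularHomology.isIso_map_of_interior_union_interior_holds R M P)
      (d.interior_U_union_interior_V ht) k) ≪≫ e.symm⟩

end Gluing

/-! ### The crux's `X` is a homotopy 4-sphere -/

open Summit.SmoothPoincare4.SmoothPoincare4.Theorems.ContractibleTwistedDoubleStandard.LegendrianRKnotRigidity in
/-- **A contact Stein bisection of a `4`-manifold by two compact contractible domains is a homotopy
`4`-sphere.**  Let the Hausdorff second-countable smooth `4`-manifold `X` be covered by two smoothly
embedded compact contractible Stein domains `e₁(W₁)`, `e₂(W₂)` meeting exactly along `e₁(∂W₁)` and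
along `e₂(∂W₂)`, with complex tangencies pushed forward to the same planes at common points.  Then
`X ≃ₕ S⁴`: with the seam diffeomorphism `ψ : ∂W₁ ≅ ∂W₂` (`stub_seam`) and a collar of `∂W₂`, `X` is the
gluing `W₁ ∪_ψ W₂` (`BoundaryCollar.GluingData`), hence simply connected (van Kampen, both pieces
contractible, `∂W₂` connected by Lefschetz duality mod 2) with `H₂(X; ℤ) ≅ H₁(∂W₂; ℤ) = 0`
(Mayer–Vietoris; Alexander duality, Kervaire–Milnor Lemma 2.3), and the recognition theorem for
homotopy `4`-spheres (Freedman–Quinn §10.1, proved in the tree) concludes.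
[cite: KervaireMilnorAnnals1963, Lemma 2.3] [cite: FreedmanQuinnPMS1990, §10.1] [cite: HatcherAT2002, Thm. 1.20 and §2.2] -/
theorem nonempty_homotopyEquiv_sphere_of_steinBisection
    {X : Type} [TopologicalSpace X] [T2Space X] [SecondCountableTopology X]
    [ChartedSpace (EuclideanSpace ℝ (Fin 4)) X] [IsManifold (𝓡 4) ∞ X]
    {W₁ : Type} [TopologicalSpace W₁] [ChartedSpace (EuclideanHalfSpace 4) W₁]
    [IsManifold (𝓡∂ 4) ∞ W₁] [CompactSpace W₁] [ContractibleSpace W₁]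
    {W₂ : Type} [TopologicalSpace W₂] [ChartedSpace (EuclideanHalfSpace 4) W₂]
    [IsManifold (𝓡∂ 4) ∞ W₂] [CompactSpace W₂] [ContractibleSpace W₂]
    (J₁ : SteinStructure W₁) (J₂ : SteinStructure W₂) {e₁ : W₁ → X} {e₂ : W₂ → X}
    (h1 : Manifold.IsSmoothEmbedding (𝓡∂ 4) (𝓡 4) ∞ e₁)
    (h2 : Manifold.IsSmoothEmbedding (𝓡∂ 4) (𝓡 4) ∞ e₂)
    (hcov : Set.range e₁ ∪ Set.range e₂ = Set.univ)
    (hL : Set.range e₁ ∩ Set.range e₂ = e₁ '' (𝓡∂ 4).boundary W₁)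
    (hR : Set.range e₁ ∩ Set.range e₂ = e₂ '' (𝓡∂ 4).boundary W₂)
    (hC : ∀ w₁ w₂, e₁ w₁ = e₂ w₂ →
      Submodule.map (mfderiv (𝓡∂ 4) (𝓡 4) e₁ w₁).toLinearMap (contactPlane J₁.J w₁) =
        Submodule.map (mfderiv (𝓡∂ 4) (𝓡 4) e₂ w₂).toLinearMap (contactPlane J₂.J w₂)) :
    Nonempty (X ≃ₕ Metric.sphere (0 : EuclideanSpace ℝ (Fin 5)) 1) := by
  -- the halves inherit the Hausdorff and second-countability properties of `X`
  haveI : T2Space W₁ := h1.isEmbedding.t2Space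
  haveI : SecondCountableTopology W₁ := h1.isEmbedding.secondCountableTopology
  haveI : T2Space W₂ := h2.isEmbedding.t2Space
  haveI : SecondCountableTopology W₂ := h2.isEmbedding.secondCountableTopology
  -- `X` is compact (union of two compact images)
  haveI : CompactSpace X := by
    refine ⟨?_⟩
    rw [← hcov]
    exact (isCompact_range h1.isEmbedding.continuous).union (isCompact_range h2.isEmbedding.continuous)
  -- boundary data and the seam diffeomorphism
  obtain ⟨b₁⟩ : Nonempty (BoundaryData (𝓡∂ 4) W₁ (𝓡 3)) := nonempty_boundaryData_holds 3 W₁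
  obtain ⟨b₂⟩ : Nonempty (BoundaryData (𝓡∂ 4) W₂ (𝓡 3)) := nonempty_boundaryData_holds 3 W₂
  obtain ⟨ψ, hψ, -⟩ := stub_seam X W₁ W₂ J₁ J₂ e₁ e₂ h1 h2 hL hR hC b₁ b₂
  -- `∂W₂` is nonempty, connected, hence path connected; and compact
  haveI : ConnectedSpace b₂.carrier :=
    Literature.Barriers.SmoothPoincare4.connectedSpace_boundaryCarrier_of_contractibleSpace
      (n := 2) b₂
  haveI : LocallyPathConnectedSpace b₂.carrier :=
    ChartedSpace.locallyPathConnectedSpace (EuclideanSpace ℝ (Fin 3)) b₂.carrier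
  haveI : PathConnectedSpace b₂.carrier := pathConnectedSpace_iff_connectedSpace.2 inferInstance
  haveI : CompactSpace b₂.carrier := b₂.compactSpace_carrier
  -- `W₂` as a null-cobordism of `∂W₂`, and a topological collar of `∂W₂`
  let c₀ : NullCobordism 3 b₂.carrier :=
    { W := W₂, incl := b₂.incl, isSmoothEmbedding_incl := b₂.isSmoothEmbedding,
      range_incl := b₂.range_incl }
  haveI : ContractibleSpace c₀.W := ‹ContractibleSpace W₂›
  obtain ⟨κ, hκ⟩ := c₀.exists_boundaryCollar
  -- the gluing data `X = W₁ ∪_ψ W₂`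
  let i₁ : b₂.carrier → W₁ := fun w => b₁.incl (ψ.symm w)
  let d : κ.GluingData i₁ X :=
    { j₁ := e₁, j₂ := e₂,
      isClosedEmbedding_j₁ :=
        h1.isEmbedding.continuous.isClosedEmbedding h1.isEmbedding.injective,
      isClosedEmbedding_j₂ :=
        h2.isEmbedding.continuous.isClosedEmbedding h2.isEmbedding.injective,
      range_union_range := hcov,
      j₁_eq_j₂_iff := fun a a' => by
        constructor
        · intro h
          have hmem : e₁ a ∈ range e₁ ∩ range e₂ := ⟨⟨a, rfl⟩, ⟨a', h.symm⟩⟩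
          rw [hL] at hmem
          obtain ⟨a₀, ha₀, hae⟩ := hmem
          have haa : a₀ = a := h1.isEmbedding.injective hae
          subst haa
          have ha : a₀ ∈ range b₁.incl := by rw [b₁.range_incl]; exact ha₀
          obtain ⟨z, rfl⟩ := ha
          refine ⟨ψ z, ?_, h2.isEmbedding.injective ?_⟩
          · simp [i₁]
          · rw [hκ, hψ z]
            exact h.symm
        · rintro ⟨w, rfl, rfl⟩
          rw [hκ]
          have := hψ (ψ.symm w)
          simp only [Diffeomorph.apply_symm_apply] at this
          exact this.symm }
  -- van Kampen: `X` is simply connected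
  haveI : SimplyConnectedSpace X :=
    d.simplyConnectedSpace fun a γ => ⟨Path.refl a, SimplyConnectedSpace.paths_homotopic _ _⟩
  -- Mayer–Vietoris: `H₂(X; ℤ) ≅ H₁(∂W₂; ℤ)`
  obtain ⟨e⟩ := gluingData_nonempty_singularHomology_iso d ℤ ℤ (k := 1) one_ne_zero
  -- Alexander duality: `H₁(∂W₂; ℤ) = 0`
  have hH₁ : IsZero (singularHomology ℤ ℤ b₂.carrier 1) :=
    c₀.isZero_singularHomology_of_alexander
      (isZero_localHomologyOfSet_of_contractible_nhds_holds ℤ) le_rfl one_le_two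
  have hH₂ : IsZero (singularHomology ℤ ℤ X 2) := hH₁.of_iso e
  -- recognition of homotopy 4-spheres
  exact (nonempty_homotopyEquiv_sphere_four_iff_holds X).2 ⟨inferInstance, hH₂⟩

/-- **Registered stub `stub_homotopySphere` of skeleton m10 (line `property-r-mazur-halves`) — a
contact Stein bisection of a closed `4`-manifold by two compact contractible Stein domains is a
homotopy `4`-sphere**, in the crux's binder order; it is
`nonempty_homotopyEquiv_sphere_of_steinBisection` verbatim (the `[CompactSpace X]` binder of the crux
is carried, not used). [cite: KervaireMilnorAnnals1963, Lemma 2.3] [cite: FreedmanQuinnPMS1990, §10.1] -/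
theorem stub_homotopySphere :
    ∀ (X : Type) [TopologicalSpace X] [T2Space X] [SecondCountableTopology X] [CompactSpace X]
      [ChartedSpace (EuclideanSpace ℝ (Fin 4)) X] [IsManifold (𝓡 4) ∞ X]
      (W₁ : Type) [TopologicalSpace W₁] [ChartedSpace (EuclideanHalfSpace 4) W₁]
      [IsManifold (𝓡∂ 4) ∞ W₁] [CompactSpace W₁] [ContractibleSpace W₁]
      (W₂ : Type) [TopologicalSpace W₂] [ChartedSpace (EuclideanHalfSpace 4) W₂]
      [IsManifold (𝓡∂ 4) ∞ W₂] [CompactSpace W₂] [ContractibleSpace W₂]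
      (J₁ : SteinStructure W₁) (J₂ : SteinStructure W₂) (e₁ : W₁ → X) (e₂ : W₂ → X),
      Manifold.IsSmoothEmbedding (𝓡∂ 4) (𝓡 4) ∞ e₁ → Manifold.IsSmoothEmbedding (𝓡∂ 4) (𝓡 4) ∞ e₂ →
      Set.range e₁ ∪ Set.range e₂ = Set.univ →
      Set.range e₁ ∩ Set.range e₂ = e₁ '' (𝓡∂ 4).boundary W₁ →
      Set.range e₁ ∩ Set.range e₂ = e₂ '' (𝓡∂ 4).boundary W₂ →
      (∀ w₁ w₂, e₁ w₁ = e₂ w₂ →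
        Submodule.map (mfderiv (𝓡∂ 4) (𝓡 4) e₁ w₁).toLinearMap (contactPlane J₁.J w₁) =
          Submodule.map (mfderiv (𝓡∂ 4) (𝓡 4) e₂ w₂).toLinearMap (contactPlane J₂.J w₂)) →
      Nonempty (X ≃ₕ Metric.sphere (0 : EuclideanSpace ℝ (Fin 5)) 1) :=
  fun _ _ _ _ _ _ _ _ _ _ _ _ _ _ _ _ _ _ _ J₁ J₂ _ _ h1 h2 hcov hL hR hC =>
    nonempty_homotopyEquiv_sphere_of_steinBisection J₁ J₂ h1 h2 hcov hL hR hC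

end Summit.SmoothPoincare4.SmoothPoincare4.Theorems.ContractibleTwistedDoubleStandard.PropertyRMazurHalves

end
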